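import Summits.BirchSwinnertonDyer.BirchSwinnertonDyer.Theorems.ManinLocalTwoThreeEvenManinKummerSquare
import Summits.BirchSwinnertonDyer.Rank1Residual.ManinAdditive.CuspidalKummerClassHolds
import Mathlib.RingTheory.PowerSeries.Ideal
import Mathlib.RingTheory.Polynomial.RationalRoot
import HarnessLib

/-!
# E-an-52 `ManinOddOfOddEtaExponent` PROVED: the cuspidal-Kummer CERTIFICATE for an odd Manin constant

Summit `BirchSwinnertonDyer`, route `ManinLocalTwoThree` (cell bsd-f2-manin), deciding crux C2
`ManinOddAtFour` (stmt-BirchSwinnertonDyer-22967), reducible residual `Rb` of the line `kato_shift_two`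
(lead p1).  MEMO-an §56.4 (typed leaf `…ManinAdditive.CuspidalKummerClass`, REF1 §R50 «theorem modulo
47 ∧ 49⁺, UFD step valid»): **if some rational 2-torsion point of an `X₀(N)`-parametrised curve with
`4 ∣ N` has a CUSPIDAL KUMMER REPRESENTATIVE `(r, g, A, B)` with an odd `η`-exponent `r_δ`, the Manin
constant is odd.**  Proved here BY NAME, unconditionally:

  `ManinOddOfOddEtaExponent_holds : ManinOddOfOddEtaExponent`

from the two support rows now in the tree — E-an-47 `EvenManinKummerSquare_holds`
(`ManinLocalTwoThreeEvenManinKummerSquare`: `2 ∣ c ⇒ Ξ·B′² = A′²` in `ℚ₂⟦q⟧`, `A′, B′ ∈ ℤ₂⟦q⟧`) and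
E-an-49⁺ `EtaUnitSquareIffEven_holds` (`CuspidalKummerClassHolds`: an `η`-unit series is a `2`-adic
square iff all exponents are even) — and the UFD step: the representative's `Ξ·B²·qⁿ¹ = qⁿ²·g·A²`
gives `qⁿ²·g·(AB′)² = qⁿ¹·(A′B)²` in `ℤ₂⟦q⟧` (`A ≠ 0` since `Ξ(0) = 1`); comparing `q`-orders,
`n₁ ≡ n₂ (mod 2)` and `g·F′² = G′²` with `F′ ≠ 0` (`exists_mul_sq_eq_sq_of_X_pow`); `ℤ₂⟦q⟧` is
factorial (Mathlib: `R⟦X⟧` is a UFD for a PID `R`) hence integrally closed, so `g` is a square in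
`ℤ₂⟦q⟧` (`isSquare_of_mul_sq_eq_sq`), whence every `r_δ` is even — contradiction.

HONEST FRAMING: the certificate's INPUTS — K_geo (E-an-48: every rational 2-torsion point of an optimal
curve with `4 ∣ N` has a cuspidal Kummer representative) and E-an-53 (a non-blind point has an odd
exponent) — stay OPEN; the totally blind classes (E-an-50) are untouched.  Nothing about BSD, Manin's
conjecture, or any particular curve's Manin constant is asserted here.
-/

set_option autoImplicit false
set_option linter.dupNamespace false

noncomputable section

open scoped Classical
open PowerSeries WeierstrassCurve Literature.NumberTheory.EllipticCurves Literature.NumberTheory.EllipticCurves.ModularForms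
  Literature.RingTheory.FormalGroups
open Summit.BirchSwinnertonDyer.Rank1Residual.ManinAdditive.CuspidalKummer

namespace Summit.BirchSwinnertonDyer.BirchSwinnertonDyer.Theorems.ManinLocalTwoThree

section Certificate

/-- **UFD step.** In an integrally closed domain, `g·F² = G²` with `F ≠ 0` forces `g` to be a square
(`G/F` is integral, being a square root of `g`). [folklore] -/
theorem isSquare_of_mul_sq_eq_sq {R : Type*} [CommRing R] [IsDomain R] [IsIntegrallyClosed R]
    {g F G : R} (hF : F ≠ 0) (h : g * F ^ 2 = G ^ 2) : IsSquare g := by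
  let K := FractionRing R
  have hFK : algebraMap R K F ≠ 0 :=
    fun h0 => hF (IsFractionRing.injective R K (by rw [h0, map_zero]))
  set ρ : K := algebraMap R K G / algebraMap R K F with hρ
  have hρ2 : ρ ^ 2 = algebraMap R K g := by
    have h' := congrArg (algebraMap R K) h
    rw [map_mul, map_pow, map_pow] at h'
    rw [hρ, div_pow, div_eq_iff (pow_ne_zero 2 hFK), ← h', mul_comm]
  have hint : IsIntegral R ρ := IsIntegral.of_pow two_pos (by rw [hρ2]; exact isIntegral_algebraMap)
  obtain ⟨h₀, hh₀⟩ := IsIntegrallyClosed.algebraMap_eq_of_integral hint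
  refine ⟨h₀, IsFractionRing.injective R K ?_⟩
  rw [map_mul, hh₀, ← sq, hρ2]

/-- Parity bookkeeping in a power-series domain: from `Xᵃ·g·F² = Xᵇ·G²` with `g(0) ≠ 0` a unit and
`F, G ≠ 0` one gets `g·F'² = G'²` for some `F' ≠ 0` (compare `X`-orders: `a ≡ b (mod 2)`, then move
the even power of `X` into the square). [folklore] -/
theorem exists_mul_sq_eq_sq_of_X_pow {R : Type*} [CommRing R] [IsDomain R] {g F G : R⟦X⟧} {a b : ℕ}
    (hg : IsUnit g) (hF : F ≠ 0) (hG : G ≠ 0) (h : X ^ a * g * F ^ 2 = X ^ b * G ^ 2) :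
    ∃ F' G' : R⟦X⟧, F' ≠ 0 ∧ g * F' ^ 2 = G' ^ 2 := by
  -- compare `X`-orders: `a + 2·ord F = b + 2·ord G`
  have hord := congrArg PowerSeries.order h
  rw [order_mul, order_mul, order_X_pow, order_zero_of_unit hg, add_zero, order_pow, order_mul,
    order_X_pow, order_pow, ← coe_toNat_order hF, ← coe_toNat_order hG] at hord
  set kF := F.order.toNat
  set kG := G.order.toNat
  have hnat : a + 2 * kF = b + 2 * kG := by
    have : ((a + 2 * kF : ℕ) : ℕ∞) = ((b + 2 * kG : ℕ) : ℕ∞) := by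
      push_cast
      simpa [two_nsmul, two_mul] using hord
    exact_mod_cast this
  have hX : ∀ n : ℕ, (X : R⟦X⟧) ^ n ≠ 0 := fun n => pow_ne_zero n X_ne_zero
  rcases le_total a b with hab | hab
  · -- `b = a + 2m`: cancel `Xᵃ`, `g F² = (Xᵐ G)²`
    obtain ⟨m, hm⟩ : ∃ m, b = a + 2 * m := ⟨kF - kG, by omega⟩
    refine ⟨F, X ^ m * G, hF, ?_⟩
    have h' : X ^ a * (g * F ^ 2) = X ^ a * ((X ^ m * G) ^ 2) := by
      rw [← mul_assoc, h, hm, pow_add, pow_mul]; ring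
    exact mul_left_cancel₀ (hX a) h'
  · -- `a = b + 2m`: `g (Xᵐ F)² = G²`
    obtain ⟨m, hm⟩ : ∃ m, a = b + 2 * m := ⟨kG - kF, by omega⟩
    refine ⟨X ^ m * F, G, mul_ne_zero (hX m) hF, ?_⟩
    have h' : X ^ b * (g * (X ^ m * F) ^ 2) = X ^ b * G ^ 2 := by
      rw [← h, hm, pow_add, pow_mul]; ring
    exact mul_left_cancel₀ (hX b) h'

/-- **Theorem E-an-52 (`ManinOddOfOddEtaExponent`, cell bsd-f2-manin, MEMO-an §56.4), PROVED — THE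
CERTIFICATE: a cuspidal Kummer representative with an ODD `η`-exponent forces an ODD Manin constant.**
Proof = E-an-47 (`EvenManinKummerSquare_holds`) ∧ E-an-49⁺ (`EtaUnitSquareIffEven_holds`, tree) ∧ the
UFD step: `2 ∣ c ⇒ Ξ·B′² = A′²` in `ℚ₂⟦q⟧` with `A′, B′ ∈ ℤ₂⟦q⟧`; with the representative
`Ξ·B²·qⁿ¹ = qⁿ²·g·A²` this gives `qⁿ²·g·(AB′)² = qⁿ¹·(A′B)²` in `ℤ₂⟦q⟧`, so (orders, then
`ℤ₂⟦q⟧` factorial — Mathlib — hence integrally closed) `g` is a square in `ℤ₂⟦q⟧`, so every `r_δ` is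
even.  `c`-free input, Euler-system-free.  Nothing about BSD or Manin's conjecture is asserted; the
inputs K_geo (E-an-48) and E-an-53 of an's programme stay open. [folklore] -/
theorem ManinOddOfOddEtaExponent_holds : ManinOddOfOddEtaExponent := by
  intro W hWell hWmin N hN D a ha h4 e he z hz r g A B hrep hodd h2c
  obtain ⟨-, hEta, hB0, -, n₁, n₂, -, hEq⟩ := hrep
  obtain ⟨A', B', hB', hsq⟩ := EvenManinKummerSquare_holds W D a ha h4 e he z hz h2c
  set Ξ := kummerSeries W D.c e z with hΞ
  -- the three coefficient maps `ℚ → ℚ₂`, `ℤ → ℤ₂`, `ℤ₂ → ℚ₂` are compatible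
  have hcompat : ∀ P : ℤ⟦X⟧, PowerSeries.map (Rat.castHom ℚ_[2]) (PowerSeries.map (Int.castRingHom ℚ) P) =
      PowerSeries.map PadicInt.Coe.ringHom (PowerSeries.map (Int.castRingHom ℤ_[2]) P) := fun P => by
    rw [map_map_apply, map_map_apply,
      Subsingleton.elim ((Rat.castHom ℚ_[2]).comp (Int.castRingHom ℚ))
        ((PadicInt.Coe.ringHom (p := 2)).comp (Int.castRingHom ℤ_[2]))]
  have hκinj : Function.Injective (PowerSeries.map (PadicInt.Coe.ringHom (p := 2))) :=
    PowerSeries.map_injective _ (fun x y h => PadicInt.ext h)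
  have hιQinj : Function.Injective (PowerSeries.map (Int.castRingHom ℚ)) :=
    PowerSeries.map_injective _ (RingHom.injective_int _)
  have hιZinj : Function.Injective (PowerSeries.map (Int.castRingHom ℤ_[2])) :=
    PowerSeries.map_injective _ (RingHom.injective_int _)
  -- `Ξ ≠ 0` (constant term `1`), hence `A ≠ 0`
  have hΞ0 : constantCoeff Ξ = 1 := by
    rw [hΞ, kummerSeries, map_sub,
      Literature.RingTheory.FormalGroups.constantCoeff_subst_of_constantCoeff_eq_zero hz.1,
      constantCoeff_formalXMulSq, smul_eq_C_mul, map_mul, map_pow, hz.1]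
    simp
  have hΞne : Ξ ≠ 0 := fun h => by rw [h, map_zero] at hΞ0; exact zero_ne_one hΞ0
  have hAne : A ≠ 0 := by
    intro hA
    rw [hA] at hEq
    simp only [zero_pow two_ne_zero, mul_zero, map_zero] at hEq
    rcases mul_eq_zero.mp hEq with h | h
    · rcases mul_eq_zero.mp h with h | h
      · exact hΞne h
      · exact hB0 (hιQinj (by rw [map_zero]; exact (pow_eq_zero_iff two_ne_zero).mp h))
    · exact X_ne_zero ((pow_eq_zero_iff' ).mp h).1
  -- the equation in `ℤ₂⟦X⟧`
  set gZ : ℤ_[2]⟦X⟧ := PowerSeries.map (Int.castRingHom ℤ_[2]) g with hgZ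
  set AZ : ℤ_[2]⟦X⟧ := PowerSeries.map (Int.castRingHom ℤ_[2]) A with hAZ
  set BZ : ℤ_[2]⟦X⟧ := PowerSeries.map (Int.castRingHom ℤ_[2]) B with hBZ
  have hE1 : PowerSeries.map (Rat.castHom ℚ_[2]) Ξ * PowerSeries.map PadicInt.Coe.ringHom BZ ^ 2 * X ^ n₁ =
      X ^ n₂ * PowerSeries.map PadicInt.Coe.ringHom gZ * PowerSeries.map PadicInt.Coe.ringHom AZ ^ 2 := by
    have h := congrArg (PowerSeries.map (Rat.castHom ℚ_[2])) hEq
    simp only [map_mul, map_pow, PowerSeries.map_X, hcompat] at h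
    exact h
  have hR : X ^ n₂ * gZ * (AZ * B') ^ 2 = X ^ n₁ * (A' * BZ) ^ 2 := by
    apply hκinj
    simp only [map_mul, map_pow, PowerSeries.map_X]
    linear_combination (-(PowerSeries.map PadicInt.Coe.ringHom B') ^ 2) * hE1 +
      X ^ n₁ * (PowerSeries.map PadicInt.Coe.ringHom BZ) ^ 2 * hsq
  have hgU : IsUnit gZ := by
    rw [isUnit_iff_constantCoeff, hgZ, ← coeff_zero_eq_constantCoeff, coeff_map,
      coeff_zero_eq_constantCoeff, hEta.1, map_one]
    exact isUnit_one
  have hFne : AZ * B' ≠ 0 :=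
    mul_ne_zero (fun h => hAne (hιZinj (by rw [map_zero]; exact h))) hB'
  have hGne : A' * BZ ≠ 0 := by
    intro h0
    rw [h0, zero_pow two_ne_zero, mul_zero] at hR
    exact (mul_ne_zero (mul_ne_zero (pow_ne_zero _ X_ne_zero) hgU.ne_zero) (pow_ne_zero 2 hFne)) hR
  obtain ⟨F', G', hF', h'⟩ := exists_mul_sq_eq_sq_of_X_pow hgU hFne hGne hR
  have hsqg : IsSquare gZ := isSquare_of_mul_sq_eq_sq hF' h'
  -- E-an-49⁺: all exponents are even — contradiction
  have h0 : (0 : ℕ) ∉ N.divisors := fun h =>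
    (NeZero.ne N) (Nat.eq_zero_of_zero_dvd (Nat.mem_divisors.mp h).1)
  have heven := (EtaUnitSquareIffEven_holds N.divisors r g h0 hEta).mp hsqg
  obtain ⟨δ, hδ, hδodd⟩ := hodd
  exact (Int.not_even_iff_odd.mpr hδodd) (heven δ hδ)

end Certificate

end Summit.BirchSwinnertonDyer.BirchSwinnertonDyer.Theorems.ManinLocalTwoThree

end
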